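import Summits.CriticalPhenomena.PercolationContinuityZ3.Theorems.Transplant.SkelPhiRootNumbersX3
import Summits.CriticalPhenomena.PercolationContinuityZ3.Theorems.Transplant.SkelPhiRootRoomsB
import Summits.CriticalPhenomena.PercolationContinuityZ3.Theorems.Transplant.SkelPhiRootServe
import Summits.CriticalPhenomena.PercolationContinuityZ3.Theorems.Transplant.SkelPhiRootServeTable
import Summits.CriticalPhenomena.PercolationContinuityZ3.Theorems.Transplant.SkelPhiCylRadOri
import Summits.CriticalPhenomena.PercolationContinuityZ3.Theorems.Transplant.SkelNegBChoiceAllS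
import Summits.CriticalPhenomena.PercolationContinuityZ3.Theorems.Transplant.SkelNegBParamsSlotsRS
import Summits.CriticalPhenomena.PercolationContinuityZ3.Theorems.Transplant.SkelNegBParamsSlots
import Summits.CriticalPhenomena.PercolationContinuityZ3.Theorems.Transplant.SkelNegBParamsExcess
import Summits.CriticalPhenomena.PercolationContinuityZ3.Theorems.Transplant.SkelPhiConcFaceRoute
import HarnessLib

/-!
# N1 (the `{±1}` node), (R) column ((R6c), x-directions): **THE ROOT RESIDUE OF THE S1 CHOICES OF RECORD AT AN x-DIRECTION, FROM `AtQO`** —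
# `PlanarSkeletonNeg.NegB.rootOblTWAt_negBS_x`: at every `(O, q)` with `(choiceAtOS …).AtQO O q`, one vertex type, for a direction `du` along the cells'
# axis `0`, `Skel.RootOblTWAt G ((choiceAtOS …).scheme O q) Φ.Δ κ.δr du` — by `Skelφ.rootOblTWAt_of_numbers3_x` with EVERYTHING STRUCTURAL DISCHARGED
# from the ledger (stmt-g14's `NegB`/`NegB.KS` chain): the long map `φL` and its frames, the fine map of record `fineO` (= `fineSkel φL t 800 n_L h_L v_L vβ …`),
# the root world / small target box of the twin scheme (`mem_U0rootb_of_footprint`, `mem_rootMb_of_footprint`), the pinned seed `Λ t k` (fat seed: contains `t`,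
# internally connected, inside `B(t, fatRadius k)` and the root cube), BOTH apron kits (`KS.apron`, `apron_ok/sizes`, `hr₀/hreach_apron`, `levels_wide`,
# counts `counts_atq` at `δr`), the kit pair's region/table (`QKO`, `RgO_QKO`, `pexXO_facts`), ALL Step-I″ inputs at every centre (`…At_of_atQOB` transported,
# `real_pexRO_gt/real_pexXO_gt` through the tables, the hop at the root), the excess radius (`NegB.Rex`, `hR₁_at`).
# WHAT REMAINS AS HYPOTHESES (for stmt-g14's slot values / FEASIBILITY): the slots `mk, Nr, qB, Rπ, yL, Rb` and the bridge data `B, Qb, Fb` (three orientation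
# cases, instantiated by the companion from `inputsBR_of_atQOS` + `bridgeSets_*`), the four root radii, the zone-in-kit-prism inclusion, and INTEGER INEQUALITIES.

builds on p205010 (kernel theorem, internal audit signed; external expert review pending) — nothing in this file uses p205010; NOTHING is claimed about the open node
`SamePDropOfSkeletonNeg₁`: this is the (R) residue of `samePDropOfSkeletonNeg₁_of_choiceFnNOW` at the x-directions modulo the listed numbers.
Lane `prim-bschramm`, seat `prim-bschramm-p3` (gen 9; design owner + (R) owner); helper file (`--supports stmt-CriticalPhenomena-4575 --as helper`).
[cite: KozmaNitzan2024, §4 Theorem 6 (pp. 25–31), p. 28 ((32) at the root), Lemma 10–12] [cite: MartineauTassion2017, §3.2, §4.3]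
-/

noncomputable section

open scoped Classical

namespace Summit.CriticalPhenomena.PercolationContinuityZ3.Theorems.Transplant

open MeasureTheory Literature.Probability.Percolation Literature.Probability.LatticeModels SimpleGraph KNCells KNLevels
open Literature.Probability.Percolation.KozmaNitzan.Cells (oth sgOf sgOf_sign stepVec_apply_fst)
open Literature.Barriers.CriticalPhenomena (graphBall mem_graphBall_self graphBall_mono)
open BoxProdZ2 (ConcRadiiG)

namespace PlanarSkeletonNeg

open SkelConc (Consts)
open Skelφ (oriφ trφ FootBox rootFrame runX xRunSched RgO pexRO pexXO ShortPcO shearUnit pgramPrismFin pgSideHalfW)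
open Skelφ.StepI (DataN OutO eventNAt)
open ChainPlanar (BridgePrm BridgeOK)
open SkelI (tanOff)

namespace NegB

open Neg

section AtQ

variable {κ : Consts} {V : Type} [DecidableEq V] [Countable V] {G : SimpleGraph V} [G.LocallyFinite] {Φ : PlanarSkeletonNeg G} {t : V} {p : unitInterval}
  {hC : Φ.CylSubcritical p} {gv fv : Neg.FSlot} {Pv : PSlot} {Sv : SSlot} {O : OutO V} {q : unitInterval}

local notation "𝔤" => gOf κ Φ t p O gv
local notation "𝔣" => fOf κ Φ t p O fv
local notation "φL°" => φL κ Φ t p O.D O.DT O.ori (gOf κ Φ t p O gv) (fOf κ Φ t p O fv)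
local notation "nL°" => nL κ Φ t p O.merged (gOf κ Φ t p O gv) (fOf κ Φ t p O fv)
local notation "hL°" => hL κ Φ t p O.merged (gOf κ Φ t p O gv) (fOf κ Φ t p O fv)
local notation "ℓL°" => ℓL κ Φ t p O.merged (gOf κ Φ t p O gv) (fOf κ Φ t p O fv)
local notation "vL°" => vL κ Φ t p O.merged (gOf κ Φ t p O gv) (fOf κ Φ t p O fv)
local notation "vβL°" => Skelφ.NegPrm.vβOf (nL κ Φ t p O.merged (gOf κ Φ t p O gv) (fOf κ Φ t p O fv)) (hL κ Φ t p O.merged (gOf κ Φ t p O gv) (fOf κ Φ t p O fv))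
  (ℓL κ Φ t p O.merged (gOf κ Φ t p O gv) (fOf κ Φ t p O fv)) (vL κ Φ t p O.merged (gOf κ Φ t p O gv) (fOf κ Φ t p O fv))
local notation "ML°" => ML κ Φ t p O.merged (gOf κ Φ t p O gv)
local notation "P°" => fcells κ Φ t p O.merged (gOf κ Φ t p O gv) (fOf κ Φ t p O fv)
local notation "Dof°" => Skelφ.NegPrm.Dof (nL κ Φ t p O.merged (gOf κ Φ t p O gv) (fOf κ Φ t p O fv)) (hL κ Φ t p O.merged (gOf κ Φ t p O gv) (fOf κ Φ t p O fv))
  (ℓL κ Φ t p O.merged (gOf κ Φ t p O gv) (fOf κ Φ t p O fv)) (vL κ Φ t p O.merged (gOf κ Φ t p O gv) (fOf κ Φ t p O fv))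
local notation "Rl°" => O.merged.R (O.merged.scale t (ML κ Φ t p O.merged (gOf κ Φ t p O gv)) (nL κ Φ t p O.merged (gOf κ Φ t p O gv) (fOf κ Φ t p O fv)))
local notation "QKO°" mk' => KS.QKO κ Φ t p O.D O.DT O.ori (gOf κ Φ t p O gv) (fOf κ Φ t p O fv) mk'
set_option maxHeartbeats 800000 in
/-- **THE ROOT RESIDUE OF THE S1 CHOICES OF RECORD AT AN x-DIRECTION** (see the module docstring for what is discharged and what is left).
[cite: KozmaNitzan2024, §4 p. 28 ((32) at the root), Lemma 10–12 (pp. 17–25)] -/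
theorem rootOblTWAt_negBS_x (hAt : (choiceAtOS κ Φ t p gv fv Sv hC Pv).AtQO O q) (h1 : Φ.types = {t}) (hp0 : 0 < (p : ℝ)) (hp1 : (p : ℝ) < 1)
    (du : MDir) (mk Nr qB Rπ Rb : ℕ) (hNr : 0 + 1 + Nr ≤ 1000) (yL : Site 2)
    -- the two extra pairs are listed
    (hPk : (KS.MK O.merged mk, KS.nKit O.merged mk) ∈ (Pv κ Φ t p O.merged).1)
    -- the root radii of the fibre schedule of record
    (hRQ : Rπ + 1 ≤ (schedOf κ Φ t p O.merged 𝔤 𝔣 (Sv κ Φ t p O.merged 𝔤 𝔣 q)).rQ 0 0)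
    (hRB : Rπ + 1 ≤ (schedOf κ Φ t p O.merged 𝔤 𝔣 (Sv κ Φ t p O.merged 𝔤 𝔣 q)).rB 0 0 du)
    (hRQ' : Rπ + 1 ≤ (schedOf κ Φ t p O.merged 𝔤 𝔣 (Sv κ Φ t p O.merged 𝔤 𝔣 q)).rQ 0 ((0 : Site 2) + stepVec du))
    (hRM : Rπ + 1 ≤ (schedOf κ Φ t p O.merged 𝔤 𝔣 (Sv κ Φ t p O.merged 𝔤 𝔣 q)).rM 0 ((0 : Site 2) + stepVec du))
    -- the zone lies in the kit pair's prism at every centre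
    (hΛRg : ∀ c, O.merged.Λ c (Mu O.merged) ⊆ KS.RgK G t O.merged mk (KS.φK Φ t O.D O.DT O.ori mk) c)
    -- the seed's fine footprint: `|φL a − φL t| ≤ k` read by `kA` into the root cube
    {kA : ℤ} (hkA0 : 20 * ((P°).K : ℤ) * ((P°).s 0 : ℤ) * (|(800 : ℤ)| * (|vβL°| + |vL°|) * (O.merged.k : ℤ)) ≤ kA * Dof°)
    (hkA1 : 20 * ((P°).K : ℤ) * ((P°).s 1 : ℤ) * (|(800 : ℤ)| * (|((nL° : ℕ) : ℤ)| + |hL°|) * (O.merged.k : ℤ)) ≤ kA * Dof°)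
    (hkAQ : kA + 1 ≤ 5 * ((P°).r du.1 : ℤ) ∧ kA + 1 ≤ 5 * ((P°).r (oth du.1) : ℤ))
    (hρπ : Skelφ.fatRadius Φ.frame hC O.merged.k ≤ Rπ)
    -- the bridge frame and the bridge stride (any of the three orientation cases of NEG-SCOPE B.13)
    (B : BridgePrm) (hB : BridgeOK B) (hBR' : KS.RA' κ Φ t p O.merged mk ≤ B.R')
    (Qb Fb : V → Finset V)
    (hQb : ∀ c, ∀ w ∈ Qb c, w ∈ graphBall G c Rb ∧
      rootFrame φL° t (sgOf du) w ∈ Finset.Icc (rootFrame φL° t (sgOf du) c - ((B.pr : ℕ) : Site 2)) (rootFrame φL° t (sgOf du) c + ((B.pr : ℕ) : Site 2)))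
    (hFb : ∀ c, ∀ w ∈ Fb c, w ∈ Qb c ∧ rootFrame φL° t (sgOf du) w ∈ Finset.Icc (rootFrame φL° t (sgOf du) c + B.dlo) (rootFrame φL° t (sgOf du) c + B.dhi))
    (hFZ : ∀ c, Disjoint (Fb c) (O.merged.Λ c (Mu O.merged)))
    (hbridge : ∀ c, 1 - κ.δr (0 + 1 + Nr) ^ 2 < (bondPercolation G q).real (linkIn (↑(Qb c) : Set V) (O.merged.Λ c O.merged.k) (Fb c)))
    -- ROOM NUMBERS (a): the hop's landing box inside core `0` of the bridge; the long prism inside the window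
    (hB0 : Finset.Icc (Skelφ.pt nL° (sgOf du * hL°)) (Skelφ.pt nL° (sgOf du * hL° + ℓL°)) ⊆ Finset.Icc B.B₀lo B.B₀hi) (hRlπ : Rl° ≤ Rπ)
    -- ROOM NUMBERS (b): near-root reach of the bridge region and the hop prism, read by `kR`
    {sR kR : ℤ} (hsR : ∀ x ∈ Finset.Icc B.regionLo B.regionHi, ∀ i, |x i| ≤ sR) (hsQ : (Skelφ.pgScale nL° hL° (3 * ℓL°) : ℤ) ≤ sR)
    (hkR0 : 20 * ((P°).K : ℤ) * ((P°).s 0 : ℤ) * (|(800 : ℤ)| * (|vβL°| + |vL°|) * sR) ≤ kR * Dof°)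
    (hkR1 : 20 * ((P°).K : ℤ) * ((P°).s 1 : ℤ) * (|(800 : ℤ)| * (|((nL° : ℕ) : ℤ)| + |hL°|) * sR) ≤ kR * Dof°)
    (hfR : -(5 * ((P°).r du.1 : ℤ)) + 1 ≤ -kR ∧ kR ≤ 25 * ((P°).r du.1 : ℤ) - 1 ∧ kR ≤ 5 * ((P°).r (oth du.1) : ℤ) - 2)
    -- ROOM NUMBERS (c): the run's prism and last core as x-frame boxes and their fine readings (root world / small target box)
    {paLo pbLo paHi pbHi laLo lbLo laHi lbHi : ℤ}
    (hprism : (xRunSched nL° ℓL° hL° (KS.RA' κ Φ t p O.merged mk) qB Nr).prism ⊆ Finset.Icc (Skelφ.pt paLo pbLo) (Skelφ.pt paHi pbHi))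
    (hlastc : (xRunSched nL° ℓL° hL° (KS.RA' κ Φ t p O.merged mk) qB Nr).core (Nr + 1) ⊆ Finset.Icc (Skelφ.pt laLo lbLo) (Skelφ.pt laHi lbHi))
    {PLO PHI LLO LHI : Site 2}
    (hP0 : PLO 0 ≤ TwoAxis.Para.coarse (20 * ((P°).K : ℤ) * ((P°).s 0 : ℤ)) (Dof° / 2) Dof° (TwoAxis.Para.lam0 800 vL° vβL° yL) +
      (20 * ((P°).K : ℤ) * ((P°).s 0 : ℤ) * (800 * (TwoAxis.Para.modulus nL° hL° vL° vβL° * (min (sgOf du * paLo) (sgOf du * paHi)) -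
        max (vL° * ((shearUnit nL° hL° : ℤ) * (min (sgOf du * pbLo) (sgOf du * pbHi) - 1))) (vL° * ((shearUnit nL° hL° : ℤ) * (max (sgOf du * pbLo) (sgOf du * pbHi)) + shearUnit nL° hL° - 1))) / nL°)) / Dof°)
    (hP1 : TwoAxis.Para.coarse (20 * ((P°).K : ℤ) * ((P°).s 0 : ℤ)) (Dof° / 2) Dof° (TwoAxis.Para.lam0 800 vL° vβL° yL) +
      (20 * ((P°).K : ℤ) * ((P°).s 0 : ℤ) * (800 * (TwoAxis.Para.modulus nL° hL° vL° vβL° * (max (sgOf du * paLo) (sgOf du * paHi)) -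
        min (vL° * ((shearUnit nL° hL° : ℤ) * (min (sgOf du * pbLo) (sgOf du * pbHi) - 1))) (vL° * ((shearUnit nL° hL° : ℤ) * (max (sgOf du * pbLo) (sgOf du * pbHi)) + shearUnit nL° hL° - 1))) / nL°)) / Dof°
        + 1 ≤ PHI 0)
    (hP2 : PLO 1 ≤ TwoAxis.Para.coarse (20 * ((P°).K : ℤ) * ((P°).s 1 : ℤ)) (Dof° / 2) Dof° (TwoAxis.Para.lam1 800 nL° hL° yL) +
      (20 * ((P°).K : ℤ) * ((P°).s 1 : ℤ) * (800 * ((shearUnit nL° hL° : ℤ) * (min (sgOf du * pbLo) (sgOf du * pbHi) - 1)))) / Dof°)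
    (hP3 : TwoAxis.Para.coarse (20 * ((P°).K : ℤ) * ((P°).s 1 : ℤ)) (Dof° / 2) Dof° (TwoAxis.Para.lam1 800 nL° hL° yL) +
      (20 * ((P°).K : ℤ) * ((P°).s 1 : ℤ) * (800 * ((shearUnit nL° hL° : ℤ) * (max (sgOf du * pbLo) (sgOf du * pbHi)) + shearUnit nL° hL° - 1))) / Dof° + 1 ≤ PHI 1)
    (hPf₁ : sgOf du = 1 → -(5 * ((P°).r du.1 : ℤ)) + 1 ≤ PLO du.1 ∧ PHI du.1 ≤ 25 * ((P°).r du.1 : ℤ) - 1)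
    (hPf₂ : sgOf du = -1 → -(5 * ((P°).r du.1 : ℤ)) + 1 ≤ -PHI du.1 ∧ -PLO du.1 ≤ 25 * ((P°).r du.1 : ℤ) - 1)
    (hPf₃ : -(5 * ((P°).r (oth du.1) : ℤ) - 2) ≤ PLO (oth du.1) ∧ PHI (oth du.1) ≤ 5 * ((P°).r (oth du.1) : ℤ) - 2)
    (hL0 : LLO 0 ≤ TwoAxis.Para.coarse (20 * ((P°).K : ℤ) * ((P°).s 0 : ℤ)) (Dof° / 2) Dof° (TwoAxis.Para.lam0 800 vL° vβL° yL) +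
      (20 * ((P°).K : ℤ) * ((P°).s 0 : ℤ) * (800 * (TwoAxis.Para.modulus nL° hL° vL° vβL° * (min (sgOf du * laLo) (sgOf du * laHi)) -
        max (vL° * ((shearUnit nL° hL° : ℤ) * (min (sgOf du * lbLo) (sgOf du * lbHi) - 1))) (vL° * ((shearUnit nL° hL° : ℤ) * (max (sgOf du * lbLo) (sgOf du * lbHi)) + shearUnit nL° hL° - 1))) / nL°)) / Dof°)
    (hL1 : TwoAxis.Para.coarse (20 * ((P°).K : ℤ) * ((P°).s 0 : ℤ)) (Dof° / 2) Dof° (TwoAxis.Para.lam0 800 vL° vβL° yL) +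
      (20 * ((P°).K : ℤ) * ((P°).s 0 : ℤ) * (800 * (TwoAxis.Para.modulus nL° hL° vL° vβL° * (max (sgOf du * laLo) (sgOf du * laHi)) -
        min (vL° * ((shearUnit nL° hL° : ℤ) * (min (sgOf du * lbLo) (sgOf du * lbHi) - 1))) (vL° * ((shearUnit nL° hL° : ℤ) * (max (sgOf du * lbLo) (sgOf du * lbHi)) + shearUnit nL° hL° - 1))) / nL°)) / Dof°
        + 1 ≤ LHI 0)
    (hL2 : LLO 1 ≤ TwoAxis.Para.coarse (20 * ((P°).K : ℤ) * ((P°).s 1 : ℤ)) (Dof° / 2) Dof° (TwoAxis.Para.lam1 800 nL° hL° yL) +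
      (20 * ((P°).K : ℤ) * ((P°).s 1 : ℤ) * (800 * ((shearUnit nL° hL° : ℤ) * (min (sgOf du * lbLo) (sgOf du * lbHi) - 1)))) / Dof°)
    (hL3 : TwoAxis.Para.coarse (20 * ((P°).K : ℤ) * ((P°).s 1 : ℤ)) (Dof° / 2) Dof° (TwoAxis.Para.lam1 800 nL° hL° yL) +
      (20 * ((P°).K : ℤ) * ((P°).s 1 : ℤ) * (800 * ((shearUnit nL° hL° : ℤ) * (max (sgOf du * lbLo) (sgOf du * lbHi)) + shearUnit nL° hL° - 1))) / Dof° + 1 ≤ LHI 1)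
    (hLg₁ : sgOf du = 1 → 20 * ((P°).r du.1 : ℤ) - (b0 κ Φ t p O.merged 𝔤 𝔣 du.1 : ℤ) + 1 ≤ LLO du.1 ∧
      LHI du.1 ≤ 20 * ((P°).r du.1 : ℤ) + (b0 κ Φ t p O.merged 𝔤 𝔣 du.1 : ℤ) - 1)
    (hLg₂ : sgOf du = -1 → 20 * ((P°).r du.1 : ℤ) - (b0 κ Φ t p O.merged 𝔤 𝔣 du.1 : ℤ) + 1 ≤ -LHI du.1 ∧
      -LLO du.1 ≤ 20 * ((P°).r du.1 : ℤ) + (b0 κ Φ t p O.merged 𝔤 𝔣 du.1 : ℤ) - 1)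
    (hLg₃ : -((b0 κ Φ t p O.merged 𝔤 𝔣 (oth du.1) : ℤ) - 1) ≤ LLO (oth du.1) ∧ LHI (oth du.1) ≤ (b0 κ Φ t p O.merged 𝔤 𝔣 (oth du.1) : ℤ) - 1)
    -- ROOM NUMBERS (d): the cross link, the clearances, the reaches inside the window; late thresholds inside the window; excess radii
    (hxa : ∀ x ∈ Finset.Icc B.core1Lo B.core1Hi, |x 0 - sgOf du * yL 0| ≤ qB)
    (hxb : ∀ x ∈ Finset.Icc B.core1Lo B.core1Hi,
      |sgOf du * ((nL° : ℤ) * (x 1 - yL 1) - hL° * (sgOf du * x 0 - yL 0))| + shearUnit nL° hL° ≤ ((nL° * ℓL° / shearUnit nL° hL° + 1 : ℕ) : ℤ) * shearUnit nL° hL°)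
    (hclr : (O.merged.k : ℤ) < paLo + sgOf du * yL 0) (hclr₁ : (O.merged.k : ℤ) < B.B₀lo 0 - B.R' - B.pr)
    (hπ1 : (B.core1Lo 0).natAbs + (B.core1Lo 1).natAbs ≤ Rπ) (hπ2 : (yL 0).natAbs + (yL 1).natAbs + (Nr + 1) * shearUnit nL° hL° ≤ Rπ)
    (hRb₀ : KS.r₀A Φ t O.merged mk Rb ≤ Rπ) (hRr₀ : KS.r₀A Φ t O.merged mk Rl° ≤ Rπ) (hRbπ : Rb ≤ Rπ)
    (hR₁b : Rex κ Φ (2 * Rπ) q (Skelφ.fatRadius Φ.frame hC O.merged.k) ≤ Rπ - KS.r₀A Φ t O.merged mk Rb)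
    (hR₁r : Rex κ Φ (2 * Rπ) q (Skelφ.fatRadius Φ.frame hC O.merged.k) ≤ Rπ - KS.r₀A Φ t O.merged mk Rl°) :
    Skel.RootOblTWAt G ((choiceAtOS κ Φ t p gv fv Sv hC Pv).scheme O q) Φ.Δ κ.δr du := by
  obtain ⟨hF, hq1, hq2, hCq⟩ := factsO_of_atQOS hAt
  have hAtB := atQOB_of_atQOS hAt
  obtain ⟨hm₀k, hk1, hkM₀, hReq, hΛeq⟩ := hF.seed
  have hσ : sgOf du = 1 ∨ sgOf du = -1 := sgOf_sign du
  have hEqL := clauseL_of_atQOS hAt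
  have hNL : EqNumL κ Φ t p O.merged 𝔤 𝔣 := eqNumL_of_atQOS hAt
  obtain ⟨hnL, hℓL⟩ := one_le_of_eqNumL κ Φ t p O.merged 𝔤 𝔣 hNL
  have hκL : (hL°).natAbs ≤ 10 * nL° := hEqL.2
  have hκL10 : |hL°| ≤ 10 * ((nL° : ℕ) : ℤ) := by rw [← Int.natCast_natAbs]; exact_mod_cast hκL
  have hlip : Skelφ.Lip G φL° := lip_φL κ Φ t p O.D O.DT O.ori 𝔤 𝔣
  have hstep : Skelφ.Steps G φL° := steps_φL κ Φ t p O.D O.DT O.ori 𝔤 𝔣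
  have hfr : Skelφ.Frames G φL° Φ.types := Skelφ.frames_oriφ Φ.frame _
  have hκc : Skelφ.CylConn G φL° Φ.types := Skelφ.cylConn_oriφ Φ.cyl_connected _
  have hAf : (0 : ℤ) ≤ 800 := by norm_num
  have hmf : 0 ≤ TwoAxis.Para.modulus nL° hL° vL° vβL° := (Skelφ.NegPrm.modulus_vβOf_pos hnL hℓL _ _).le
  have hc0 := Skelφ.NegPrm.c_nonneg (P°) 0
  have hc1 := Skelφ.NegPrm.c_nonneg (P°) 1
  have hDf : 0 < Dof° := Skelφ.NegPrm.Dof_pos hnL hℓL _ _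
  let FS := Skelφ.fineSkel φL° t 800 nL° hL° vL° vβL° (20 * ((P°).K : ℤ) * ((P°).s 0 : ℤ)) (20 * ((P°).K : ℤ) * ((P°).s 1 : ℤ)) (Dof° / 2) (Dof° / 2) Dof°
  have hfine : fineO κ Φ t p O.D O.DT O.ori 𝔤 𝔣 = FS := rfl
  have hlipF : Skelφ.Lip G (fineO κ Φ t p O.D O.DT O.ori 𝔤 𝔣) := lip_fine_at κ Φ t p O.merged 𝔤 𝔣 hlip hNL
  have hwsF : Skelφ.WeakSteps G (fineO κ Φ t p O.D O.DT O.ori 𝔤 𝔣) := weakSteps_fine_at κ Φ t p O.merged 𝔤 𝔣 hstep hNL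
  let S : KSchA V ℕ := (choiceAtOS κ Φ t p gv fv Sv hC Pv).scheme O q
  have hroot : S.Γ.root = t := rfl
  let Λs := schedOf κ Φ t p O.merged 𝔤 𝔣 (Sv κ Φ t p O.merged 𝔤 𝔣 q)
  have hUfoot : ∀ w ∈ graphBall G t Rπ, FootBox (-(5 * ((P°).r du.1 : ℤ)) + 1) (25 * ((P°).r du.1 : ℤ) - 1) (5 * ((P°).r (oth du.1) : ℤ) - 2) du (FS w) →
      w ∈ S.U0root du := by
    intro w hw hfb
    rw [← hfine] at hfb
    exact Skelφ.mem_U0rootb_of_footprint (P°) t Λs du (b0 κ Φ t p O.merged 𝔤 𝔣) q κ.δ hlipF hwsF hRQ hRB hRQ' hw hfb.1 hfb.2.1 hfb.2.2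
  have hMfoot : ∀ w ∈ graphBall G t Rπ, FootBox (20 * ((P°).r du.1 : ℤ) - (b0 κ Φ t p O.merged 𝔤 𝔣 du.1 : ℤ) + 1)
      (20 * ((P°).r du.1 : ℤ) + (b0 κ Φ t p O.merged 𝔤 𝔣 du.1 : ℤ) - 1) ((b0 κ Φ t p O.merged 𝔤 𝔣 (oth du.1) : ℤ) - 1) du (FS w) →
      w ∈ S.Γ.M S.Γ.a₀ ((0 : Site 2) + stepVec du) := by
    intro w hw hfb
    rw [← hfine] at hfb
    have ha : |sgOf du * (fineO κ Φ t p O.D O.DT O.ori 𝔤 𝔣 w) du.1 - 20 * ((P°).r du.1 : ℤ)| ≤ (b0 κ Φ t p O.merged 𝔤 𝔣 du.1 : ℤ) - 1 :=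
      abs_le.2 ⟨by linarith [hfb.1], by linarith [hfb.2.1]⟩
    exact Skelφ.mem_rootMb_of_footprint (P°) t Λs du (b0 κ Φ t p O.merged 𝔤 𝔣) hlipF hwsF hRM hw ha hfb.2.2
  -- ### the pinned seed: the fat seed at level `k`
  let A : Finset V := O.merged.Λ t O.merged.k
  have hAfat : A = Skelφ.fatSeq Φ.frame hC t O.merged.k := by show O.merged.Λ t O.merged.k = _; rw [hΛeq]
  have htA : t ∈ A := by
    rw [hAfat, Skelφ.mem_fatSeq_iff]; exact Skelφ.self_mem_cylBall G Φ.φ t _ _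
  have hAconn : ∀ a ∈ A, PathIn G (↑A : Set V) t a := by
    rw [hAfat, ← Skelφ.fatSeqOff_zero]; exact Skelφ.pathIn_fatSeqOff Φ.frame hC 0 t _
  have hAρ : ∀ a ∈ A, a ∈ graphBall G t (Skelφ.fatRadius Φ.frame hC O.merged.k) := by
    intro a ha
    rw [hAfat, Skelφ.mem_fatSeq_iff] at ha
    exact (Skelφ.cylBall_subset_prism G Φ.φ t _ _ ha).1
  have hAbox : ∀ a ∈ A, |φL° a 0 - φL° t 0| ≤ (O.merged.k : ℤ) ∧ |φL° a 1 - φL° t 1| ≤ (O.merged.k : ℤ) := by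
    intro a ha
    have hc : a ∈ Skelφ.cyl Φ.φ t O.merged.k := by
      rw [hAfat] at ha; exact Skelφ.fatSeq_subset_cyl Φ.frame hC t _ (Finset.mem_coe.2 ha)
    have hc' : a ∈ Skelφ.cyl φL° t O.merged.k := by unfold NegB.φL; rwa [Skelφ.cyl_oriφ]
    rw [Skelφ.mem_cyl, mem_box] at hc'
    have h0 := hc' 0; have h1 := hc' 1
    simp only [Pi.sub_apply] at h0 h1
    exact ⟨abs_le.2 ⟨h0.1, h0.2⟩, abs_le.2 ⟨h1.1, h1.2⟩⟩
  have hAφ : ∀ a ∈ A, |φL° a 0 - φL° t 0| ≤ ((O.merged.k : ℕ) : ℤ) := fun a ha => (hAbox a ha).1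
  have hAQ : A ⊆ S.Γ.Q S.Γ.a₀ 0 := by
    intro a ha
    obtain ⟨h0, h1⟩ := hAbox a ha
    obtain ⟨k0, k1⟩ := Skelφ.abs_fineSkel_le_of_near (φ := φL°) t hDf hc0 hc1 hkA0 hkA1 h0 h1
    have hall : ∀ i : Fin 2, |(FS a) i| ≤ kA := fun i => by
      fin_cases i
      · exact k0
      · exact k1
    have hs : |sgOf du * (FS a) du.1| ≤ kA := by
      rw [abs_mul, show |sgOf du| = 1 by rcases hσ with h | h <;> simp [h], one_mul]; exact hall du.1
    have hs' := abs_le.1 hs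
    have h₁ : -(5 * ((P°).r du.1 : ℤ)) + 1 ≤ sgOf du * (fineO κ Φ t p O.D O.DT O.ori 𝔤 𝔣 a) du.1 := by rw [hfine]; linarith [hs'.1, hkAQ.1]
    have h₂ : sgOf du * (fineO κ Φ t p O.D O.DT O.ori 𝔤 𝔣 a) du.1 ≤ 5 * ((P°).r du.1 : ℤ) := by rw [hfine]; linarith [hs'.2, hkAQ.1]
    have h₃ : |(fineO κ Φ t p O.D O.DT O.ori 𝔤 𝔣 a) (oth du.1)| ≤ 5 * ((P°).r (oth du.1) : ℤ) - 1 := by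
      rw [hfine]; exact (hall (oth du.1)).trans (by linarith [hkAQ.2])
    have hmem := Skelφ.mem_rootQ_of_footprint (P°) t Λs du hlipF hwsF hRQ (graphBall_mono G t hρπ (hAρ a ha)) h₁ h₂ h₃
    change a ∈ (Skelφ.cellGeomSG₂b G (fineO κ Φ t p O.D O.DT O.ori 𝔤 𝔣) (P°) t Λs (b0 κ Φ t p O.merged 𝔤 𝔣)).Q 0 0
    rw [Skelφ.cellGeomSG₂b_Q]; exact hmem
  obtain ⟨cL, hcLπ, hcL⟩ := Skelφ.exists_mem_graphBall_φ_eq hstep t (φL° t + yL)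
  have hcLπ' : cL ∈ graphBall G t ((yL 0).natAbs + (yL 1).natAbs) := by
    simpa only [Pi.add_apply, add_sub_cancel_left] using hcLπ
  -- ### levels and the two kits of record
  have hRA := KS.RA'_eq κ Φ t p O.merged mk
  have hRl₁ : KS.RlevA κ Φ t p O.merged mk + 1 ≤ B.R' := hRA.2.1 ▸ hBR'
  have hRl₂ : KS.RlevA κ Φ t p O.merged mk + 1 ≤ KS.RA' κ Φ t p O.merged mk := hRA.2.1.le
  have hj : KS.j₁A κ Φ t p O.merged mk ≤ KS.RlevA κ Φ t p O.merged mk := hRA.2.2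
  let Pb : Skelφ.ApronPrm := KS.apron Φ t O.merged mk ((Mu O.merged : ℤ) + 2) (KS.r₀A Φ t O.merged mk Rb)
  let Pr : Skelφ.ApronPrm := KS.apron Φ t O.merged mk ((Mu O.merged + 1 : ℕ) * (shearUnit nL° hL° : ℤ) + 1) (KS.r₀A Φ t O.merged mk Rl°)
  obtain ⟨hPNb, hd1b, hD1b, hD2b, hDρb, hℓb, hWb, hKmaxb, hKCmaxb, hR'b, hTb, hT'b⟩ :=
    KS.apron_ok Φ t O.merged mk ((Mu O.merged : ℤ) + 2) (KS.r₀A Φ t O.merged mk Rb) (c := 1) (by norm_num)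
  obtain ⟨hPNr, hd1r, hD1r, hD2r, hDρr, hℓr, hWr, hKmaxr, hKCmaxr, hR'r, hTr, hT'r⟩ :=
    KS.apron_ok Φ t O.merged mk ((Mu O.merged + 1 : ℕ) * (shearUnit nL° hL° : ℤ) + 1) (KS.r₀A Φ t O.merged mk Rl°) (c := 11) le_rfl
  obtain ⟨hrsb, hcSb⟩ := KS.apron_sizes Φ t O.merged mk ((Mu O.merged : ℤ) + 2) (KS.r₀A Φ t O.merged mk Rb)
  obtain ⟨hrsr, hcSr⟩ := KS.apron_sizes Φ t O.merged mk ((Mu O.merged + 1 : ℕ) * (shearUnit nL° hL° : ℤ) + 1) (KS.r₀A Φ t O.merged mk Rl°)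
  have hr₀b := KS.hr₀_apron Φ t O.merged mk ((Mu O.merged : ℤ) + 2) (KS.r₀A_ge Φ t O.merged mk Rb).1
  have hr₀r := KS.hr₀_apron Φ t O.merged mk ((Mu O.merged + 1 : ℕ) * (shearUnit nL° hL° : ℤ) + 1) (KS.r₀A_ge Φ t O.merged mk Rl°).1
  have hreachb := KS.hreach_apron Φ t O.merged mk ((Mu O.merged : ℤ) + 2) (KS.r₀A_ge Φ t O.merged mk Rb).2
  have hreachr := KS.hreach_apron Φ t O.merged mk ((Mu O.merged + 1 : ℕ) * (shearUnit nL° hL° : ℤ) + 1) (KS.r₀A_ge Φ t O.merged mk Rl°).2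
  have hR'b' : Skelφ.cylRadMax G φL° Φ.types Pb.ℓ (KS.Rs t O.merged mk + KS.KCmax t O.merged mk + (Pb.W + KS.Kmax t O.merged mk)) ≤ Pb.R' := by
    unfold NegB.φL; rw [Skelφ.cylRadMax_oriφ]; exact hR'b
  have hR'r' : Skelφ.cylRadMax G φL° Φ.types Pr.ℓ (KS.Rs t O.merged mk + KS.KCmax t O.merged mk + (Pr.W + KS.Kmax t O.merged mk)) ≤ Pr.R' := by
    unfold NegB.φL; rw [Skelφ.cylRadMax_oriφ]; exact hR'r
  have hT₀b : tanOff Pb.ℓs Pb.M = KS.T₀a t O.merged mk := KS.tanOff_apron Φ t O.merged mk _ _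
  have hT₀r : tanOff Pr.ℓs Pr.M = KS.T₀a t O.merged mk := KS.tanOff_apron Φ t O.merged mk _ _
  have hDb : Skelφ.shellD Pb = KS.Dsh t O.merged mk := KS.shellD_apron Φ t O.merged mk _ _
  have hDr : Skelφ.shellD Pr = KS.Dsh t O.merged mk := KS.shellD_apron Φ t O.merged mk _ _
  have hdb : Pb.d = KS.da t O.merged mk := rfl
  have hdr : Pr.d = KS.da t O.merged mk := rfl
  have hwin : ∀ {lo hi : Site 2} (_ : lo ≤ hi) {j : ℕ} (_ : KS.j₀A t O.merged mk ≤ j) (X : ℤ) (_ : X ≤ 2 * (j : ℤ)) (i : Fin 2),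
      (lo - (j : Site 2)) i + X ≤ (hi + (j : Site 2)) i := by
    intro lo hi hlohi j hj X hX i
    have h := hlohi i
    simp only [Pi.sub_apply, Pi.add_apply, Pi.natCast_apply]
    linarith
  have hLW := fun {j : ℕ} (hj : KS.j₀A t O.merged mk ≤ j) => KS.levels_wide t O.merged mk hj
  have hwideb : ∀ j, KS.j₀A t O.merged mk ≤ j → j ≤ KS.j₁A κ Φ t p O.merged mk →
      ∀ i, (B.B₀lo - (j : Site 2)) i + 2 * tanOff Pb.ℓs Pb.M ≤ (B.B₀hi + (j : Site 2)) i := fun j hj _ i =>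
    hwin hB.h0 hj _ (by rw [hT₀b]; exact_mod_cast (hLW hj).1) i
  have hdwb : ∀ j, KS.j₀A t O.merged mk ≤ j → j ≤ KS.j₁A κ Φ t p O.merged mk →
      ∀ i, (B.B₀lo - (j : Site 2)) i + (Pb.d + 2 : ℕ) ≤ (B.B₀hi + (j : Site 2)) i := fun j hj _ i =>
    hwin hB.h0 hj _ (by rw [hdb]; exact_mod_cast (hLW hj).2.1) i
  have hDwb : ∀ j, KS.j₀A t O.merged mk ≤ j → j ≤ KS.j₁A κ Φ t p O.merged mk →
      ∀ i, (B.B₀lo - (j : Site 2)) i + ((Skelφ.shellD Pb + 1 + Pb.d + KS.KCmax t O.merged mk + KS.Rs t O.merged mk : ℕ) : ℤ) ≤ (B.B₀hi + (j : Site 2)) i :=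
    fun j hj _ i => hwin hB.h0 hj _ (by rw [hDb, hdb]; exact_mod_cast (hLW hj).2.2) i
  let SN := xRunSched nL° ℓL° hL° (KS.RA' κ Φ t p O.merged mk) qB Nr
  have hcore : ∀ k ≤ Nr + 1, SN.lo k ≤ SN.hi k := fun k hk => by
    have h := SN.nonempty k hk
    exact Finset.nonempty_Icc.1 h
  have hwider : ∀ k ≤ Nr, ∀ j, KS.j₀A t O.merged mk ≤ j → j ≤ KS.j₁A κ Φ t p O.merged mk →
      ∀ i, (SN.lo k - (j : Site 2)) i + 2 * tanOff Pr.ℓs Pr.M ≤ (SN.hi k + (j : Site 2)) i := fun k hk j hj _ i =>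
    hwin (hcore k (by omega)) hj _ (by rw [hT₀r]; exact_mod_cast (hLW hj).1) i
  have hdwr : ∀ k ≤ Nr, ∀ j, KS.j₀A t O.merged mk ≤ j → j ≤ KS.j₁A κ Φ t p O.merged mk →
      ∀ i, (SN.lo k - (j : Site 2)) i + (Pr.d + 2 : ℕ) ≤ (SN.hi k + (j : Site 2)) i := fun k hk j hj _ i =>
    hwin (hcore k (by omega)) hj _ (by rw [hdr]; exact_mod_cast (hLW hj).2.1) i
  have hDwr : ∀ k ≤ Nr, ∀ j, KS.j₀A t O.merged mk ≤ j → j ≤ KS.j₁A κ Φ t p O.merged mk →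
      ∀ i, (SN.lo k - (j : Site 2)) i + ((Skelφ.shellD Pr + 1 + Pr.d + KS.KCmax t O.merged mk + KS.Rs t O.merged mk : ℕ) : ℤ) ≤ (SN.hi k + (j : Site 2)) i :=
    fun k hk j hj _ i => hwin (hcore k (by omega)) hj _ (by rw [hDr, hdr]; exact_mod_cast (hLW hj).2.2) i
  have hEb : KS.j₁A κ Φ t p O.merged mk + (Pb.N * (tanOff Pb.ℓs Pb.M + 1) + Pb.N * Pb.d + KS.KCmax t O.merged mk) ≤ B.R' := by
    have h := KS.j_reach_le κ Φ t p O.merged mk (le_refl (KS.j₁A κ Φ t p O.merged mk))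
    rw [hT₀b, hdb]; unfold KS.reachA at h
    have hN : Pb.N = 13 := rfl
    rw [hN]; omega
  have hEr : KS.j₁A κ Φ t p O.merged mk + (Pr.N * (tanOff Pr.ℓs Pr.M + 1) + Pr.N * Pr.d + KS.KCmax t O.merged mk) ≤ KS.RA' κ Φ t p O.merged mk := by
    have h := KS.j_reach_le κ Φ t p O.merged mk (le_refl (KS.j₁A κ Φ t p O.merged mk))
    rw [hT₀r, hdr]; unfold KS.reachA at h
    have hN : Pr.N = 13 := rfl
    rw [hN]; omega
  -- counts at accuracy `δr n`
  have hδkit : Neg.δkit κ Φ ≤ κ.δr (0 + 1 + Nr) := Neg.δkit_le_δr κ Φ hNr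
  obtain ⟨hk, hcount⟩ := KS.counts_R κ Φ t p O.merged mk hp0 hp1 hq1 hq2 hδkit
  have hkN : KS.kkA κ Φ t p O.merged mk * (Φ.Δ + 1) ^ (2 * KS.rsA Φ t O.merged mk) ≤ KS.NkA κ Φ t p O.merged mk :=
    KS.hNk_at κ Φ t p O.merged mk hp0 hp1
  have hδr : 0 < κ.δr (0 + 1 + Nr) := (κ.hδr _).1
  have hδI : Neg.δI κ Φ ≤ κ.δr (0 + 1 + Nr) ^ 2 := Neg.δI_le_sq_of_le κ Φ hδkit
  have hδI' : Neg.δI κ Φ ≤ κ.δr (0 + 1 + Nr) := by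
    have h1 : κ.δr (0 + 1 + Nr) ≤ 1 := (κ.hδr _).2
    have h2 : κ.δr (0 + 1 + Nr) ^ 2 ≤ κ.δr (0 + 1 + Nr) := by rw [sq]; exact mul_le_of_le_one_right hδr.le h1
    exact hδI.trans h2
  have hηδ : Neg.η κ Φ ≤ κ.δr (0 + 1 + Nr) / 2 := by linarith [(Neg.η_pos κ Φ).2.1, hδkit]
  -- ### the kit pair's region and tables
  obtain ⟨hnSK, hκSK, hℓSK⟩ := KS.pexXO_facts_of_atQOS (g := 𝔤) (f := 𝔣) mk hAt
  have hQKf := fun c => KS.QKO_facts κ Φ t p O.D O.DT O.ori 𝔤 𝔣 mk c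
  have hRgRs : ∀ c, (QKO° mk).RS c ≤ KS.Rs t O.merged mk := fun c => by rw [(hQKf c).2.2.2.1]; exact (KS.RK_le_Rs t O.merged mk).1
  have hRgcard : ∀ c, (RgO G φL° (QKO° mk) c).card ≤ KS.cUA Φ t O.merged mk := fun c => by
    rw [KS.RgO_QKO]; exact KS.card_RgK_le Φ t O.merged mk _ c
  have hcU1 := KS.hcU1_at Φ t O.merged mk
  -- the zone family
  have hkM : O.merged.k ≤ Mu O.merged := hkM₀
  have hkn : ∀ c, O.merged.Λ c O.merged.k ⊆ O.merged.Λ c (Mu O.merged) := fun c => by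
    rw [hΛeq]; exact Skelφ.fatSeq_monotone Φ.frame hC c hkM
  have hZφ : ∀ c, (↑(O.merged.Λ c (Mu O.merged)) : Set V) ⊆ Skelφ.cyl Φ.φ c (Mu O.merged) := fun c => by
    rw [hΛeq]; exact Skelφ.fatSeq_subset_cyl Φ.frame hC c _
  have hZ : ∀ c, (↑(O.merged.Λ c (Mu O.merged)) : Set V) ⊆ Skelφ.cyl φL° c (Mu O.merged) := fun c => by
    unfold NegB.φL; rw [Skelφ.cyl_oriφ]; exact hZφ c
  have hΛ : ∀ c, ∀ v ∈ O.merged.Λ c (Mu O.merged), v ∈ RgO G φL° (QKO° mk) c ∧ φL° v - φL° c ∈ box 2 (Mu O.merged) := fun c v hv => by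
    refine ⟨?_, ?_⟩
    · rw [KS.RgO_QKO]; exact hΛRg c hv
    · exact (Skelφ.mem_cyl (φ := φL°) c (Mu O.merged) v).1 (hZ c (Finset.mem_coe.2 hv))
  have hMz : Mu O.merged < nL° := lt_of_le_of_lt (Mu_le_ML κ Φ t p O.merged 𝔤) (ML_lt_nL κ Φ t p O.merged 𝔤 𝔣).1
  -- ### the Step-I″ inputs at every centre
  have hzone : ∀ c, 1 - κ.δr (0 + 1 + Nr) ^ 2 < (bondPercolation G S.p).real (UniqZone.zone G (O.merged.Λ c) O.merged.k (Mu O.merged)) :=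
    fun c => lt_of_le_of_lt (by linarith [hδI]) (zoneAt_of_atQOB hAtB h1 c)
  -- kit pair: the table entries are served
  have hQ : ∀ c, (QKO° mk).nS c = KS.nKit O.merged mk ∧ (QKO° mk).hS c = O.merged.hgt t (KS.MK O.merged mk) (KS.nKit O.merged mk) ∧
      (QKO° mk).ℓS c = O.merged.len t (KS.MK O.merged mk) (KS.nKit O.merged mk) ∧
      (QKO° mk).RS c = O.merged.R (O.merged.scale t (KS.MK O.merged mk) (KS.nKit O.merged mk)) ∧
      (QKO° mk).vS c = O.merged.spl t (KS.MK O.merged mk) (KS.nKit O.merged mk) := fun c => ⟨rfl, rfl, rfl, rfl, rfl⟩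
  have hservedK : ∀ (c : V) (fam : Fin 2) (σ' τ' : ℤˣ), 1 - κ.δr (0 + 1 + Nr) ^ 2 < (bondPercolation G q).real
      (linkIn (Skelφ.StepI.regionNAt G (oriφ φL° ((QKO° mk).oS c)) O.merged t c (KS.MK O.merged mk) (KS.nKit O.merged mk))
        (O.merged.Λ c O.merged.k) (Skelφ.StepI.pieceNAt G (oriφ φL° ((QKO° mk).oS c)) O.merged t c (KS.MK O.merged mk) (KS.nKit O.merged mk) fam σ' τ')) := by
    intro c fam σ' τ'
    have h := inputsExtraAt_of_atQOB hAtB h1 c hPk fam σ' τ'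
    rw [Skelφ.StepI.eventNAt_some] at h
    have hmap : oriφ φL° ((QKO° mk).oS c) = oriφ Φ.φ (O.ori t (KS.MK O.merged mk) (KS.nKit O.merged mk)) := by
      rw [(hQKf c).2.2.2.2.2, KS.oriφ_φL_oS]; rfl
    rw [hmap]
    have h' : 1 - κ.δr (0 + 1 + Nr) ^ 2 ≤ 1 - Neg.δI κ Φ := by linarith
    exact lt_of_le_of_lt h' h
  have hexitb := Skelφ.real_pexRO_gt (φ := φL°) (Λ := O.merged.Λ) (k := O.merged.k) hQ hservedK (Mu O.merged) Pb.A hσ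
  have hexitr := Skelφ.real_pexXO_gt (φ := φL°) (Λ := O.merged.Λ) (k := O.merged.k) hQ hservedK (Mu O.merged) nL° hL° Pr.A hσ
  -- the long links at every centre and the hop at the root
  have hlong : ∀ c (τ : ℤ), τ = 1 ∨ τ = -1 → 1 - κ.δr (0 + 1 + Nr) ^ 2 < (bondPercolation G S.p).real
      (linkIn (Skelφ.pgramPrism G φL° c nL° hL° (3 * ℓL°) Rl°) (O.merged.Λ c O.merged.k) (pgSideHalfW G φL° c nL° hL° ℓL° Rl° (sgOf du) (sgOf du * τ))) := by
    intro c τ hτ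
    have hστ : sgOf du * τ = 1 ∨ sgOf du * τ = -1 := by rcases hσ with h | h <;> rcases hτ with h' | h' <;> simp [h, h']
    have h := inputsLAt_of_atQOB hAtB h1 c 0 (Skelφ.sgnU (sgOf du)) (Skelφ.sgnU (sgOf du * τ))
    rw [Skelφ.StepI.eventNAt_some] at h
    unfold Skelφ.StepI.regionNAt Skelφ.StepI.pieceNAt at h
    rw [if_pos rfl, Skelφ.val_sgnU hσ, Skelφ.val_sgnU hστ] at h
    exact lt_of_le_of_lt (by linarith [hδI]) h
  have hlink : 1 - κ.δr (0 + 1 + Nr) < (bondPercolation G S.p).real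
      (linkIn (↑(pgramPrismFin G φL° t nL° hL° (3 * ℓL°) Rl°) : Set V) A (pgSideHalfW G φL° t nL° hL° ℓL° Rl° (sgOf du) 1)) := by
    have h := inputsL_of_atQOS hAt 0 (Skelφ.sgnU (sgOf du)) 1
    rw [Skelφ.StepI.eventN_some] at h
    unfold Skelφ.StepI.regionN Skelφ.StepI.pieceN at h
    rw [if_pos rfl, Skelφ.val_sgnU hσ, Units.val_one] at h
    rw [Skelφ.StepI.coe_pgramPrismFin]
    exact lt_of_le_of_lt (by linarith [hδI']) h
  -- ### the excess radius
  -- (`hR₁_at` carries the classical instance inside `Neg.η`; the two `η`s agree by `Subsingleton.elim`)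
  have hηδ' : @Neg.η κ V (fun a b => Classical.propDecidable (a = b)) _ G _ Φ ≤ κ.δr (0 + 1 + Nr) / 2 := by convert hηδ using 2
  have hR₁ := hR₁_at κ Φ (2 * Rπ) hCq (oL κ Φ t p O.D O.DT O.ori 𝔤 𝔣) hηδ' t (Skelφ.fatRadius Φ.frame hC O.merged.k)
  -- ### assemble
  exact Skelφ.rootOblTWAt_of_numbers3_x hlip hstep hfr hκc Φ.degree_le S hroot du hσ hAf hnL hL° hmf hc0 hc1 hDf hUfoot hMfoot htA hAconn hAρ hρπ hAQ hAφ
    B hB hκL ℓL° (KS.RA' κ Φ t p O.merged mk) qB Nr Rl° cL hcL hcLπ'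
    (KS.RlevA κ Φ t p O.merged mk) (KS.NkA κ Φ t p O.merged mk) (KS.j₀A t O.merged mk) (KS.j₁A κ Φ t p O.merged mk)
    (KS.RlevA κ Φ t p O.merged mk) (KS.NkA κ Φ t p O.merged mk) (KS.j₀A t O.merged mk) (KS.j₁A κ Φ t p O.merged mk)
    hRl₁ hRl₂ hj hj hB0 hRlπ hsR hsQ hkR0 hkR1 hfR hprism hlastc hP0 hP1 hP2 hP3 hPf₁ hPf₂ hPf₃ hL0 hL1 hL2 hL3 hLg₁ hLg₂ hLg₃ hxa hxb hclr hclr₁ hπ1 hπ2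
    hδr hlink hcount hcount (le_refl _) Pb Pr (le_trans (by norm_num) hPNb) rfl hd1b hD1b hD2b hDρb hℓb hWb (by simpa using hKmaxb) (by simpa using hKCmaxb) hR'b' hwideb hdwb hDwb
    hTb hT'b hr₀b hRb₀ hrsb hcSb hEb hreachb le_rfl hRbπ hPNr rfl hd1r hD1r hD2r hDρr hℓr hWr hKmaxr hKCmaxr hR'r' hwider hdwr hDwr hTr hT'r
    hr₀r hRr₀ hrsr hcSr hEr hreachr le_rfl hRlπ (QKO° mk) hRgRs hRgcard hcU1 hnSK hκSK hℓSK hκL10 O.merged.Λ O.merged.k hkn hΛ hZ hMz Qb Fb hQb hFb hFZ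
    (KS.kkA κ Φ t p O.merged mk) (KS.kkA κ Φ t p O.merged mk) hkN hkN hk hk hzone hexitb hexitr hbridge hlong hR₁ hR₁b hR₁r

end AtQ

end NegB

end PlanarSkeletonNeg

end Summit.CriticalPhenomena.PercolationContinuityZ3.Theorems.Transplant

end
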